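import Mathlib
import Summits.Ventures.PercRepro2.LocRows
import Summits.Ventures.PercRepro2.SwRow
import Summits.Ventures.PercRepro2.SwOut
import Summits.Ventures.PercRepro2.SwAllRow
import Summits.Ventures.PercRepro2.SwOutAll

/-!
# The bundle `h–u` by subdivision with outside edges: the graph `G⁺` and the cluster transport
(blind cell PercRepro2, night-4 g29, 2026-08-28; proofs/NIGHT4-G29.md §9)

`SwOutJunctionH1EdgeDefs` with EVERY edge `h–u` subdivided: the bundle `B = {e // ends e = s(h, u)}`
indexes the new vertices `w_b` (`Sum.inr b`), the edge `b` becomes `h–w_b`, and `w_b` gets the edges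
`w_b–u` (`inr (b, false)`) and `w_b–l` (`inr (b, true)`).
A configuration `ζ` of `G` lifts to `blift ζ` (`h–w_b`, `w_b–u` coloured like `b`, `w_b–l` the other
colour).  This file: `bundEnds`, `bundRegion`, `bundLift` / `blift`, push / pull of edge sets
(`b ↦ {h–w_b, w_b–u}`) and the CLUSTER TRANSPORT (`inl_mem_cluster_bundLift_iff`,
`inr_mem_cluster_bundLift_iff`): the red cluster of a vertex `x` of `G` in `G⁺` is its cluster in
`G` with the `w_b` for which `b` is red and `h` is in the cluster, or `w_b–l` is red and `l` is.
-/

namespace Summit.Ventures.PercRepro2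

namespace LocRows

open Hull

variable {V : Type*} {E : Type*}

/-! ## The bundle, the lifts, the region, push and pull -/

section Lift

variable (ends : E → Sym2 V) (h u : V)

/-- The bundle: the edges `h–u`. -/
abbrev Bundle : Type _ := {e : E // ends e = s(h, u)}

variable {ends h u}

/-- The lift of a configuration with prescribed colours `d` on the edges `w_b–l`: `h–w_b` and
`w_b–u` take the colour of `b`. -/
def bundLift (ζ : Config E) (d : Bundle ends h u → Bool) : Config (E ⊕ (Bundle ends h u × Bool))
  | Sum.inl e => ζ e
  | Sum.inr (b, false) => ζ b.1
  | Sum.inr (b, true) => d b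

/-- The uniform lift: every `w_b–l` takes the colour opposite to `b`. -/
def blift (ζ : Config E) : Config (E ⊕ (Bundle ends h u × Bool)) :=
  bundLift ζ fun b => !ζ b.1

/-- The region `U⁺ = U ∪ {w_b}`. -/
def bundRegion (U : Set V) : Set (V ⊕ Bundle ends h u) := {x | ∀ v, x = Sum.inl v → v ∈ U}

/-- The push of an edge set of `G` to `G⁺`: a bundle edge `b` goes to `{h–w_b, w_b–u}`. -/
def bundPush (F : Set E) : Set (E ⊕ (Bundle ends h u × Bool)) :=
  {e | (∃ e' ∈ F, e = Sum.inl e') ∨ (∃ b : Bundle ends h u, b.1 ∈ F ∧ e = Sum.inr (b, false))}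

/-- The pull of an edge set of `G⁺` to `G`: a bundle edge `b` is in it when both `h–w_b` and `w_b–u`
are. -/
def bundPull (F : Set (E ⊕ (Bundle ends h u × Bool))) : Set E :=
  {e | Sum.inl e ∈ F ∧ ∀ b : Bundle ends h u, b.1 = e → Sum.inr (b, false) ∈ F}

/-- The lift on the copy of an edge of `G`. -/
@[simp] lemma bundLift_inl (ζ : Config E) (d : Bundle ends h u → Bool) (e : E) :
    bundLift ζ d (Sum.inl e) = ζ e := rfl

/-- The lift on `w_b–u`: the colour of `b`. -/
@[simp] lemma bundLift_inr_false (ζ : Config E) (d : Bundle ends h u → Bool) (b : Bundle ends h u) :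
    bundLift ζ d (Sum.inr (b, false)) = ζ b.1 := rfl

/-- The lift on `w_b–l`: the prescribed colour. -/
@[simp] lemma bundLift_inr_true (ζ : Config E) (d : Bundle ends h u → Bool) (b : Bundle ends h u) :
    bundLift ζ d (Sum.inr (b, true)) = d b := rfl

/-- The uniform lift on the copy of an edge of `G`. -/
@[simp] lemma blift_inl (ζ : Config E) (e : E) : blift (ends := ends) (h := h) (u := u) ζ (Sum.inl e) = ζ e := rfl

/-- The uniform lift on `w_b–u`: the colour of `b`. -/
@[simp] lemma blift_inr_false (ζ : Config E) (b : Bundle ends h u) :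
    blift ζ (Sum.inr (b, false)) = ζ b.1 := rfl

/-- The uniform lift on `w_b–l`: the colour opposite to `b`. -/
@[simp] lemma blift_inr_true (ζ : Config E) (b : Bundle ends h u) :
    blift ζ (Sum.inr (b, true)) = !ζ b.1 := rfl

/-- The colour swap commutes with the lift (the third edges swapped too). -/
lemma blue_bundLift (ζ : Config E) (d : Bundle ends h u → Bool) :
    blue (bundLift ζ d) = bundLift (blue ζ) fun b => !d b := by
  funext e
  rcases e with e | ⟨b, c⟩
  · rfl
  · cases c <;> rfl

/-- The colour swap commutes with the uniform lift. -/
lemma blue_blift (ζ : Config E) : blue (blift (ends := ends) (h := h) (u := u) ζ) = blift (blue ζ) := by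
  funext e
  rcases e with e | ⟨b, c⟩
  · rfl
  · cases c
    · rfl
    · simp [blift, bundLift, blue]

/-- The uniform lift is injective. -/
lemma blift_injective : Function.Injective (blift : Config E → Config (E ⊕ (Bundle ends h u × Bool))) := by
  intro ζ ζ' hζ
  funext e
  have := congrFun hζ (Sum.inl e)
  simpa using this

/-- A vertex of `G` lies in `U⁺` iff it lies in `U`. -/
@[simp] lemma inl_mem_bundRegion_iff {U : Set V} {v : V} :
    (Sum.inl v : V ⊕ Bundle ends h u) ∈ bundRegion U ↔ v ∈ U := by
  simp [bundRegion]

/-- Every `w_b` lies in `U⁺`. -/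
@[simp] lemma inr_mem_bundRegion {U : Set V} {b : Bundle ends h u} :
    (Sum.inr b : V ⊕ Bundle ends h u) ∈ bundRegion U := by
  simp [bundRegion]

/-- The copy of an edge of `G` is in the push iff the edge is in the set. -/
lemma mem_bundPush_inl_iff {F : Set E} {e : E} :
    (Sum.inl e : E ⊕ (Bundle ends h u × Bool)) ∈ bundPush F ↔ e ∈ F := by
  simp only [bundPush, Set.mem_setOf_eq, Sum.inl.injEq, reduceCtorEq, and_false, exists_false,
    or_false]
  constructor
  · rintro ⟨e', he', rfl⟩
    exact he'
  · intro he
    exact ⟨e, he, rfl⟩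

/-- The edge `w_b–u` is in the push iff `b` is in the set. -/
lemma mem_bundPush_inr_false_iff {F : Set E} {b : Bundle ends h u} :
    (Sum.inr (b, false) : E ⊕ (Bundle ends h u × Bool)) ∈ bundPush F ↔ b.1 ∈ F := by
  simp only [bundPush, Set.mem_setOf_eq, reduceCtorEq, and_false, exists_false, Sum.inr.injEq,
    Prod.mk.injEq, and_true, false_or]
  constructor
  · rintro ⟨b', hb', rfl⟩
    exact hb'
  · intro hb
    exact ⟨b, hb, rfl⟩

/-- The edges `w_b–l` are never in a push. -/
lemma not_mem_bundPush_inr_true {F : Set E} {b : Bundle ends h u} :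
    (Sum.inr (b, true) : E ⊕ (Bundle ends h u × Bool)) ∉ bundPush F := by
  simp [bundPush]

/-- Pulling back a pushed edge set gives it back. -/
lemma bundPull_bundPush (F : Set E) : bundPull (bundPush (ends := ends) (h := h) (u := u) F) = F := by
  ext e
  simp only [bundPull, Set.mem_setOf_eq, mem_bundPush_inl_iff, mem_bundPush_inr_false_iff]
  constructor
  · exact fun h' => h'.1
  · exact fun he => ⟨he, fun _ hb => hb ▸ he⟩

/-- The pull is monotone. -/
lemma bundPull_mono {F F' : Set (E ⊕ (Bundle ends h u × Bool))} (hFF' : F ⊆ F') :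
    bundPull F ⊆ bundPull F' :=
  fun _ ⟨h1, h2⟩ => ⟨hFF' h1, fun b hb => hFF' (h2 b hb)⟩

/-- The preimage of an up-set of `2^E` under the pull is an up-set of `2^{E⁺}`. -/
lemma isUpperSet_bundPull_preimage {𝓔 : Set (Set E)} (h𝓔 : IsUpperSet 𝓔) :
    IsUpperSet {F : Set (E ⊕ (Bundle ends h u × Bool)) | bundPull F ∈ 𝓔} :=
  fun _ _ hFF' hF => h𝓔 (bundPull_mono hFF') hF

/-- Every element of `Sym2` is a pair. -/
lemma exists_pair_eq' (z : Sym2 V) : ∃ p q : V, z = s(p, q) :=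
  Sym2.ind (fun p q => ⟨p, q, rfl⟩) z
end Lift

/-! ## The subdivided graph -/

section Subd

open scoped Classical

variable (ends : E → Sym2 V) (h u l : V)

/-- The subdivided graph `G⁺` on `V ⊕ B` (the new vertices `w_b = Sum.inr b`) and `E ⊕ (B × Bool)`:
every bundle edge `b` becomes `h–w_b`, `inr (b, false)` is `w_b–u`, `inr (b, true)` is `w_b–l`; every
other edge of `G` keeps its ends. -/
noncomputable def bundEnds : E ⊕ (Bundle ends h u × Bool) → Sym2 (V ⊕ Bundle ends h u)
  | Sum.inl e => if hb : ends e = s(h, u) then s(Sum.inl h, Sum.inr ⟨e, hb⟩) else (ends e).map Sum.inl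
  | Sum.inr (b, false) => s(Sum.inr b, Sum.inl u)
  | Sum.inr (b, true) => s(Sum.inr b, Sum.inl l)

variable {ends h u l}

/-- The copy of a bundle edge `b` of `G⁺` is `h–w_b`. -/
lemma bundEnds_inl_of_hu {e : E} (hb : ends e = s(h, u)) :
    bundEnds ends h u l (Sum.inl e) = s(Sum.inl h, Sum.inr ⟨e, hb⟩) := by
  simp [bundEnds, hb]

/-- The copy of a bundle edge `b` of `G⁺` is `h–w_b` (subtype form). -/
lemma bundEnds_inl_bundle (b : Bundle ends h u) :
    bundEnds ends h u l (Sum.inl b.1) = s(Sum.inl h, Sum.inr b) := by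
  rw [bundEnds_inl_of_hu b.2]

/-- Every other edge of `G` keeps its ends in `G⁺`. -/
lemma bundEnds_inl_of_ne {e : E} (he : ends e ≠ s(h, u)) :
    bundEnds ends h u l (Sum.inl e) = (ends e).map Sum.inl := by
  simp [bundEnds, he]

/-- The edge `inr (b, false)` of `G⁺` is `w_b–u`. -/
@[simp] lemma bundEnds_inr_false (b : Bundle ends h u) :
    bundEnds ends h u l (Sum.inr (b, false)) = s(Sum.inr b, Sum.inl u) := rfl

/-- The edge `inr (b, true)` of `G⁺` is `w_b–l`. -/
@[simp] lemma bundEnds_inr_true (b : Bundle ends h u) :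
    bundEnds ends h u l (Sum.inr (b, true)) = s(Sum.inr b, Sum.inl l) := rfl

/-- A non-bundle edge of `G` not joining `p` and `q` does not join `inl p` and `inl q` in `G⁺`. -/
lemma bundEnds_inl_ne_of_ne {e : E} {p q : V} (he : ends e ≠ s(h, u)) (hpq : ends e ≠ s(p, q)) :
    bundEnds ends h u l (Sum.inl e) ≠ s(Sum.inl p, Sum.inl q) := by
  rw [bundEnds_inl_of_ne he]
  intro hmap
  obtain ⟨a, b, hab⟩ := exists_pair_eq' (ends e)
  rw [hab, Sym2.map_mk, Sym2.eq_iff] at hmap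
  apply hpq
  rw [hab, Sym2.eq_iff]
  rcases hmap with ⟨h1, h2⟩ | ⟨h1, h2⟩
  · exact Or.inl ⟨Sum.inl_injective h1, Sum.inl_injective h2⟩
  · exact Or.inr ⟨Sum.inl_injective h1, Sum.inl_injective h2⟩
end Subd

/-! ## The cluster transport -/

section Cluster

open scoped Classical

variable {ends : E → Sym2 V} {h u l : V} {ζ : Config E} {d : Bundle ends h u → Bool}

/-- `w_b` joins the cluster of `x`: through `h–w_b` when `b` is red and `h` is in the cluster, or
through `w_b–l` when that edge is red and `l` is in the cluster. -/
def bundWIn (ends : E → Sym2 V) (h u l : V) (ζ : Config E) (d : Bundle ends h u → Bool)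
    (x : V) (b : Bundle ends h u) : Prop :=
  (ζ b.1 = true ∧ h ∈ cluster ends ζ x) ∨ (d b = true ∧ l ∈ cluster ends ζ x)

/-- Along a red bundle edge `b`: `inl u` follows `inl h` into any cluster of `G⁺` (through `w_b`). -/
lemma inl_u_mem_of_inl_h_mem {b : Bundle ends h u} (hred : ζ b.1 = true) {y : V ⊕ Bundle ends h u}
    (hh : Sum.inl h ∈ cluster (bundEnds ends h u l) (bundLift ζ d) y) :
    Sum.inl u ∈ cluster (bundEnds ends h u l) (bundLift ζ d) y := by
  have h1 : Sum.inr b ∈ cluster (bundEnds ends h u l) (bundLift ζ d) y :=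
    mem_cluster_of_edge (e := Sum.inl b.1) hh (by simpa using hred) (bundEnds_inl_bundle b)
  exact mem_cluster_of_edge (e := Sum.inr (b, false)) h1 (by simpa using hred) (by simp)

/-- Along a red bundle edge `b`: `inl h` follows `inl u` into any cluster of `G⁺` (through `w_b`). -/
lemma inl_h_mem_of_inl_u_mem {b : Bundle ends h u} (hred : ζ b.1 = true) {y : V ⊕ Bundle ends h u}
    (hu : Sum.inl u ∈ cluster (bundEnds ends h u l) (bundLift ζ d) y) :
    Sum.inl h ∈ cluster (bundEnds ends h u l) (bundLift ζ d) y := by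
  have h1 : Sum.inr b ∈ cluster (bundEnds ends h u l) (bundLift ζ d) y :=
    mem_cluster_of_edge (e := Sum.inr (b, false)) hu (by simpa using hred)
      (by rw [bundEnds_inr_false, Sym2.eq_swap])
  exact mem_cluster_of_edge (e := Sum.inl b.1) h1 (by simpa using hred)
    (by rw [bundEnds_inl_bundle, Sym2.eq_swap])

variable (hd : ∀ b, d b = true → ζ b.1 = false)
include hd

/-- **The cluster transport, one direction**: the cluster of `inl x` in `G⁺` lies in the image of
the cluster of `x`, with the `w_b` only under `bundWIn`. -/
lemma cluster_bundLift_subset (x : V) :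
    cluster (bundEnds ends h u l) (bundLift ζ d) (Sum.inl x) ⊆
      {y | (∃ v ∈ cluster ends ζ x, y = Sum.inl v) ∨
        ∃ b, y = Sum.inr b ∧ bundWIn ends h u l ζ d x b} := by
  intro y hy
  refine mem_of_conn_of_closed (ends := bundEnds ends h u l) (ω := bundLift ζ d) ?_
    (Or.inl ⟨x, mem_cluster_self _ _ _, rfl⟩) hy
  intro a ha b hab
  obtain ⟨_, e, he, hends⟩ := openGraph_adj.1 hab
  rcases e with e | ⟨b', c⟩
  · by_cases hb : ends e = s(h, u)
    · rw [bundEnds_inl_of_hu hb, Sym2.eq_iff] at hends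
      have hred : ζ e = true := he
      rcases hends with ⟨rfl, rfl⟩ | ⟨rfl, rfl⟩
      · rcases ha with ⟨v, hv, hva⟩ | ⟨b'', hb'', _⟩
        · have hvh : v = h := Sum.inl_injective hva.symm
          subst hvh
          exact Or.inr ⟨⟨e, hb⟩, rfl, Or.inl ⟨hred, hv⟩⟩
        · exact absurd hb'' (by simp)
      · rcases ha with ⟨v, _, hva⟩ | ⟨b'', hb'', hw⟩
        · exact absurd hva (by simp)
        · have hbb : b'' = ⟨e, hb⟩ := Sum.inr_injective hb''.symm
          subst hbb
          rcases hw with ⟨_, hh⟩ | ⟨hdt, _⟩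
          · exact Or.inl ⟨h, hh, rfl⟩
          · exact absurd hred (by rw [hd _ hdt]; decide)
    · rw [bundEnds_inl_of_ne hb] at hends
      obtain ⟨p, q, hpq⟩ := exists_pair_eq' (ends e)
      rw [hpq, Sym2.map_mk, Sym2.eq_iff] at hends
      have hred : ζ e = true := he
      rcases hends with ⟨rfl, rfl⟩ | ⟨rfl, rfl⟩
      · rcases ha with ⟨v, hv, hva⟩ | ⟨b'', hb'', _⟩
        · have hvp : v = p := Sum.inl_injective hva.symm
          subst hvp
          exact Or.inl ⟨q, mem_cluster_of_edge hv hred hpq, rfl⟩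
        · exact absurd hb'' (by simp)
      · rcases ha with ⟨v, hv, hva⟩ | ⟨b'', hb'', _⟩
        · have hvq : v = q := Sum.inl_injective hva.symm
          subst hvq
          exact Or.inl ⟨p, mem_cluster_of_edge hv hred (ends_swap hpq), rfl⟩
        · exact absurd hb'' (by simp)
  · cases c
    · -- the edge `w_b–u`
      rw [bundEnds_inr_false, Sym2.eq_iff] at hends
      have hred : ζ b'.1 = true := he
      rcases hends with ⟨rfl, rfl⟩ | ⟨rfl, rfl⟩
      · rcases ha with ⟨v, _, hva⟩ | ⟨b'', hb'', hw⟩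
        · exact absurd hva (by simp)
        · have hbb : b'' = b' := Sum.inr_injective hb''.symm
          rw [hbb] at hw
          rcases hw with ⟨_, hh⟩ | ⟨hdt, _⟩
          · exact Or.inl ⟨u, mem_cluster_of_edge hh hred b'.2, rfl⟩
          · exact absurd hred (by rw [hd _ hdt]; decide)
      · rcases ha with ⟨v, hv, hva⟩ | ⟨b'', hb'', _⟩
        · have hvu : v = u := Sum.inl_injective hva.symm
          subst hvu
          exact Or.inr ⟨b', rfl, Or.inl ⟨hred, mem_cluster_of_edge hv hred (ends_swap b'.2)⟩⟩
        · exact absurd hb'' (by simp)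
    · -- the edge `w_b–l`
      rw [bundEnds_inr_true, Sym2.eq_iff] at hends
      have hdt : d b' = true := he
      rcases hends with ⟨rfl, rfl⟩ | ⟨rfl, rfl⟩
      · rcases ha with ⟨v, _, hva⟩ | ⟨b'', hb'', hw⟩
        · exact absurd hva (by simp)
        · have hbb : b'' = b' := Sum.inr_injective hb''.symm
          rw [hbb] at hw
          rcases hw with ⟨hred, _⟩ | ⟨_, hl⟩
          · exact absurd hred (by rw [hd _ hdt]; decide)
          · exact Or.inl ⟨l, hl, rfl⟩
      · rcases ha with ⟨v, hv, hva⟩ | ⟨b'', hb'', _⟩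
        · have hvl : v = l := Sum.inl_injective hva.symm
          subst hvl
          exact Or.inr ⟨b', rfl, Or.inr ⟨hdt, hv⟩⟩
        · exact absurd hb'' (by simp)

omit hd in
/-- **The cluster transport, the other direction, vertices of `G`**: the image of the cluster of `x`
lies in the cluster of `inl x`. -/
lemma inl_mem_cluster_bundLift_of_mem {x v : V} (hv : v ∈ cluster ends ζ x) :
    Sum.inl v ∈ cluster (bundEnds ends h u l) (bundLift ζ d) (Sum.inl x) := by
  refine mem_of_conn_of_closed (ends := ends) (ω := ζ)
    (S := {v | Sum.inl v ∈ cluster (bundEnds ends h u l) (bundLift ζ d) (Sum.inl x)}) ?_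
    (mem_cluster_self _ _ _) hv
  intro p hp q hpq
  obtain ⟨_, e, he, hends⟩ := openGraph_adj.1 hpq
  have hred : ζ e = true := he
  by_cases hb : ends e = s(h, u)
  · rw [hb, Sym2.eq_iff] at hends
    simp only [Set.mem_setOf_eq] at hp ⊢
    rcases hends with ⟨h1, h2⟩ | ⟨h1, h2⟩
    · rw [← h1] at hp
      rw [← h2]
      exact inl_u_mem_of_inl_h_mem (b := ⟨e, hb⟩) hred hp
    · rw [← h2] at hp
      rw [← h1]
      exact inl_h_mem_of_inl_u_mem (b := ⟨e, hb⟩) hred hp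
  · refine mem_cluster_of_edge (e := Sum.inl e) hp (by simpa using hred) ?_
    rw [bundEnds_inl_of_ne hb, hends, Sym2.map_mk]

omit hd in
/-- **The cluster transport, the other direction, the new vertices**: `w_b` lies in the cluster of
`inl x` under `bundWIn`. -/
lemma inr_mem_cluster_bundLift_of {x : V} {b : Bundle ends h u} (hw : bundWIn ends h u l ζ d x b) :
    Sum.inr b ∈ cluster (bundEnds ends h u l) (bundLift ζ d) (Sum.inl x) := by
  rcases hw with ⟨hred, hh⟩ | ⟨hdt, hl⟩
  · exact mem_cluster_of_edge (e := Sum.inl b.1) (inl_mem_cluster_bundLift_of_mem hh)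
      (by simpa using hred) (bundEnds_inl_bundle b)
  · exact mem_cluster_of_edge (e := Sum.inr (b, true)) (inl_mem_cluster_bundLift_of_mem hl)
      (by simpa using hdt) (by rw [bundEnds_inr_true, Sym2.eq_swap])

/-- **The cluster transport**: a vertex of `G` is in the cluster of `inl x` in `G⁺` iff it is in the
cluster of `x` in `G`. -/
theorem inl_mem_cluster_bundLift_iff {x v : V} :
    Sum.inl v ∈ cluster (bundEnds ends h u l) (bundLift ζ d) (Sum.inl x) ↔ v ∈ cluster ends ζ x := by
  constructor
  · intro hv
    rcases cluster_bundLift_subset hd x hv with ⟨v', hv', hvv'⟩ | ⟨b, hb, _⟩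
    · rw [Sum.inl_injective hvv']; exact hv'
    · exact absurd hb (by simp)
  · exact inl_mem_cluster_bundLift_of_mem

/-- **The cluster transport, the new vertices**: `w_b` is in the cluster of `inl x` iff `bundWIn`. -/
theorem inr_mem_cluster_bundLift_iff {x : V} {b : Bundle ends h u} :
    Sum.inr b ∈ cluster (bundEnds ends h u l) (bundLift ζ d) (Sum.inl x) ↔
      bundWIn ends h u l ζ d x b := by
  constructor
  · intro hw
    rcases cluster_bundLift_subset hd x hw with ⟨v', _, hvv'⟩ | ⟨b', hb', hw'⟩
    · exact absurd hvv' (by simp)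
    · rw [Sum.inr_injective hb']; exact hw'
  · exact inr_mem_cluster_bundLift_of
end Cluster

end LocRows

end Summit.Ventures.PercRepro2
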